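import Mathlib.Algebra.MvPolynomial.Eval
import Mathlib.LinearAlgebra.Matrix.Determinant.Basic
import Mathlib.LinearAlgebra.Matrix.NonsingularInverse
import Mathlib.LinearAlgebra.Determinant
import Mathlib.LinearAlgebra.Matrix.ToLin
import Mathlib.LinearAlgebra.FreeModule.Finite.Basic
import HarnessLib

/-!
# `t ↦ det(2 Σ tᵢ cᵢ − 1) · det(2 Σ tᵢ cᵢ + 1)` is (the evaluation of) a non-zero polynomial

Topic `LinearAlgebra/Matrix`; namespace `Literature.LinearAlgebra.Matrix`.  KERNEL ONLY (theorems, Mathlib only; no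
definition, no named fact).

§1 For a commutative ring `K`, finite index types `ι`, `n` and a family of square matrices `c : ι → Matrix n n K`,
the linear family `C(t) := Σ i, t i • c i` (`t : ι → K`) is the point evaluation of the GENERIC matrix
`G := Σ i, X i • C(c i) ∈ Matₙ(K[X_i : i ∈ ι])` (`mapMatrix_eval_sum_X_smul`), so
`t ↦ det(2 C(t) − 1) · det(2 C(t) + 1)` is the evaluation of the explicit polynomial
`P := det(2 G − 1) · det(2 G + 1) ∈ K[X_i]` (`eval_det_two_smul_sub_one_mul_det_two_smul_add_one`, by
`RingHom.map_det`); `P(0) = (−1)^{#n}` is a unit, hence `P ≠ 0` as soon as `K` is non-trivial — no hypothesis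
on `2` is needed (`det_two_smul_sub_one_mul_det_two_smul_add_one_ne_zero`).  Packaged as an existence statement
`exists_mvPolynomial_eval_eq_det` (`∃ p ≠ 0, ∀ t, eval t p = det(2 C(t) − 1) · det(2 C(t) + 1)`), and, over a
field, `exists_mvPolynomial_eval_ne_zero_iff_isUnit` (`eval t p ≠ 0 ↔` both `2 C(t) ∓ 1` invertible).
§2 The same for a family of endomorphisms `c : ι → Module.End K V` of a finite free `K`-module (`LinearMap.det`,
through `LinearMap.toMatrix` in any basis): `exists_mvPolynomial_eval_eq_linearMapDet`,
`exists_mvPolynomial_eval_ne_zero_iff_isUnit_end` — the shape consumed by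
`Literature.LinearAlgebra.Semilinear.isUnit_and_isUnit_iff_det_ne_zero` (Cayley transform on the doubled
hermitian space).
§3 Scalar tower: `E` an `F`-algebra (`F` a field), `V` an `E`-module which is finite(-dimensional) over `F`,
`c : ι → Module.End E V` and coordinates `t : ι → F`; the polynomial has coefficients in `F` (determinants of the
underlying `F`-linear maps) and `eval t p ≠ 0 ↔ 2 C(t) − 1, 2 C(t) + 1` are invertible `E`-linear maps
(`exists_mvPolynomial_eval_ne_zero_iff_isUnit_tower`; invertibility does not see the scalars,
`isUnit_iff_isUnit_restrictScalars`).

Written for the cell `hodgecm-mathlib` (fan B, rung B-IV, KEY `b4-howe-compact-irreducible`, helper H10): a locally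
constant Siegel–Weil coefficient that vanishes wherever the Cayley transform of `c` exists — i.e. off the zero locus
of `P` — vanishes identically (`Literature.NumberTheory.Automorphic.eq_zero_of_isLocallyConstant_of_eval_ne_zero`).
Not here: total-degree bounds for `P` (see `Matrix/MvPolynomialDetDegree`), affine families `c₀ + Σ tᵢ cᵢ`.

## References
* H. Weyl, *The Classical Groups*, Princeton (1939): Ch. I §1 Lemma (1.1.A) (principle of the irrelevance of
  algebraic inequalities), Ch. II §10 (Cayley's rational parametrisation; "non-exceptional" matrices
  `det(E + S) ≠ 0`), Ch. VI §2 (the unitary case over `(k, √−1)`) [Weyl1939].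
* R. Howe, *θ-series and invariant theory*, Proc. Symp. Pure Math. 33.1 (1979), §11 [Howe1979] (where the density
  of the Cayley locus enters the compact dual-pair argument).
-/

set_option autoImplicit false

namespace Literature.LinearAlgebra.Matrix

open MvPolynomial _root_.Matrix

/-! ### §1 Matrix families -/

section MatrixFamily

variable {K : Type*} [CommRing K] {ι n : Type*} [Fintype ι] [Fintype n] [DecidableEq n]

/-- **Point evaluation of the generic matrix**: evaluating the entries of `G = Σ i, X i • C(c i)` at `t` gives
`Σ i, t i • c i` ("numerical specialisation" of a formal matrix). [cite: Weyl1939, Ch. I §1, Lemma (1.1.A)] -/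
theorem mapMatrix_eval_sum_X_smul (c : ι → Matrix n n K) (t : ι → K) :
    (MvPolynomial.eval t).mapMatrix (∑ i, (X i : MvPolynomial ι K) • (c i).map (C : K →+* MvPolynomial ι K)) =
      ∑ i, t i • c i := by
  ext j k
  simp [Matrix.sum_apply]

/-- Evaluation at `t` of the generic matrix `2 G − 1` is `2 (Σ i, t i • c i) − 1`. [folklore] -/
private theorem mapMatrix_eval_two_smul_sum_X_smul_sub_one (c : ι → Matrix n n K) (t : ι → K) :
    (MvPolynomial.eval t).mapMatrix
        ((2 : MvPolynomial ι K) • (∑ i, (X i : MvPolynomial ι K) • (c i).map (C : K →+* MvPolynomial ι K)) - 1) =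
      (2 : K) • (∑ i, t i • c i) - 1 := by
  rw [map_sub, map_one, RingHom.mapMatrix_apply, Matrix.map_smul' _ _ _ (map_mul _), map_ofNat,
    ← RingHom.mapMatrix_apply, mapMatrix_eval_sum_X_smul]

/-- Evaluation at `t` of the generic matrix `2 G + 1` is `2 (Σ i, t i • c i) + 1`. [folklore] -/
private theorem mapMatrix_eval_two_smul_sum_X_smul_add_one (c : ι → Matrix n n K) (t : ι → K) :
    (MvPolynomial.eval t).mapMatrix
        ((2 : MvPolynomial ι K) • (∑ i, (X i : MvPolynomial ι K) • (c i).map (C : K →+* MvPolynomial ι K)) + 1) =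
      (2 : K) • (∑ i, t i • c i) + 1 := by
  rw [map_add, map_one, RingHom.mapMatrix_apply, Matrix.map_smul' _ _ _ (map_mul _), map_ofNat,
    ← RingHom.mapMatrix_apply, mapMatrix_eval_sum_X_smul]

/-- **`det(2 C(t) − 1) · det(2 C(t) + 1)` is the evaluation at `t` of the explicit polynomial
`P = det(2 G − 1) · det(2 G + 1) ∈ K[X_i : i ∈ ι]`**, `G = Σ i, X i • C(c i)` the generic matrix of the family
(`RingHom.map_det`): Weyl's "non-exceptional" locus `det(2c − 1) det(2c + 1) ≠ 0` of the Cayley parametrisation is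
the non-vanishing locus of a polynomial. [cite: Weyl1939, Ch. II §10] -/
theorem eval_det_two_smul_sub_one_mul_det_two_smul_add_one (c : ι → Matrix n n K) (t : ι → K) :
    MvPolynomial.eval t
        (((2 : MvPolynomial ι K) •
              (∑ i, (X i : MvPolynomial ι K) • (c i).map (C : K →+* MvPolynomial ι K)) - 1).det *
          ((2 : MvPolynomial ι K) •
              (∑ i, (X i : MvPolynomial ι K) • (c i).map (C : K →+* MvPolynomial ι K)) + 1).det) =
      ((2 : K) • (∑ i, t i • c i) - 1).det * ((2 : K) • (∑ i, t i • c i) + 1).det := by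
  rw [map_mul, RingHom.map_det, RingHom.map_det, mapMatrix_eval_two_smul_sum_X_smul_sub_one,
    mapMatrix_eval_two_smul_sum_X_smul_add_one]

/-- **Value at the origin**: `P(0) = det(−1) · det(1) = (−1)^{#n}` (`c = 0` is non-exceptional).
[cite: Weyl1939, Ch. II §10] -/
theorem eval_zero_det_two_smul_sub_one_mul_det_two_smul_add_one (c : ι → Matrix n n K) :
    MvPolynomial.eval (0 : ι → K)
        (((2 : MvPolynomial ι K) •
              (∑ i, (X i : MvPolynomial ι K) • (c i).map (C : K →+* MvPolynomial ι K)) - 1).det *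
          ((2 : MvPolynomial ι K) •
              (∑ i, (X i : MvPolynomial ι K) • (c i).map (C : K →+* MvPolynomial ι K)) + 1).det) =
      (-1) ^ Fintype.card n := by
  rw [eval_det_two_smul_sub_one_mul_det_two_smul_add_one]
  simp only [Pi.zero_apply, zero_smul, Finset.sum_const_zero, smul_zero, zero_sub, zero_add, det_one, mul_one,
    Matrix.det_neg]

/-- `P(0)` is a unit of `K` (so `P` is not the zero polynomial whenever `K ≠ 0`; no hypothesis on `2`).
[cite: Weyl1939, Ch. II §10] -/
theorem isUnit_eval_zero_det_two_smul_sub_one_mul_det_two_smul_add_one (c : ι → Matrix n n K) :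
    IsUnit (MvPolynomial.eval (0 : ι → K)
        (((2 : MvPolynomial ι K) •
              (∑ i, (X i : MvPolynomial ι K) • (c i).map (C : K →+* MvPolynomial ι K)) - 1).det *
          ((2 : MvPolynomial ι K) •
              (∑ i, (X i : MvPolynomial ι K) • (c i).map (C : K →+* MvPolynomial ι K)) + 1).det)) := by
  rw [eval_zero_det_two_smul_sub_one_mul_det_two_smul_add_one]
  exact isUnit_one.neg.pow _

/-- **`P = det(2 G − 1) · det(2 G + 1) ≠ 0`** over a non-trivial commutative ring (its value at `0` is the unit
`(−1)^{#n}`): the algebraic inequality "`c` non-exceptional" is not void, so Weyl's principle of the irrelevance of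
algebraic inequalities applies to it. [cite: Weyl1939, Ch. II §10 with Lemma (1.1.A)] -/
theorem det_two_smul_sub_one_mul_det_two_smul_add_one_ne_zero [Nontrivial K] (c : ι → Matrix n n K) :
    ((2 : MvPolynomial ι K) •
          (∑ i, (X i : MvPolynomial ι K) • (c i).map (C : K →+* MvPolynomial ι K)) - 1).det *
        ((2 : MvPolynomial ι K) •
          (∑ i, (X i : MvPolynomial ι K) • (c i).map (C : K →+* MvPolynomial ι K)) + 1).det ≠ 0 := by
  intro h
  have hu := isUnit_eval_zero_det_two_smul_sub_one_mul_det_two_smul_add_one c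
  rw [h, map_zero] at hu
  exact not_isUnit_zero hu

/-- **Packaged form**: for every family `c : ι → Matrix n n K` over a non-trivial commutative ring there is a non-zero
polynomial `p ∈ K[X_i : i ∈ ι]` with `p(t) = det(2 Σ tᵢ cᵢ − 1) · det(2 Σ tᵢ cᵢ + 1)` for all `t`.
[cite: Weyl1939, Ch. II §10 with Lemma (1.1.A)] -/
theorem exists_mvPolynomial_eval_eq_det [Nontrivial K] (c : ι → Matrix n n K) :
    ∃ p : MvPolynomial ι K, p ≠ 0 ∧ ∀ t : ι → K, MvPolynomial.eval t p =
      ((2 : K) • (∑ i, t i • c i) - 1).det * ((2 : K) • (∑ i, t i • c i) + 1).det :=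
  ⟨_, det_two_smul_sub_one_mul_det_two_smul_add_one_ne_zero c,
    eval_det_two_smul_sub_one_mul_det_two_smul_add_one c⟩

end MatrixFamily

section MatrixFamilyField

variable {K : Type*} [Field K] {ι n : Type*} [Fintype ι] [Fintype n] [DecidableEq n]

/-- **Over a field**: a non-zero polynomial `p ∈ K[X_i]` whose non-vanishing at `t` is EQUIVALENT to the
invertibility of both `2 Σ tᵢ cᵢ − 1` and `2 Σ tᵢ cᵢ + 1` (so the Cayley transform
`(2 C(t) − 1)⁻¹ (2 C(t) + 1)` exists exactly off the zero locus of `p`: Weyl's non-exceptional matrices).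
[cite: Weyl1939, Ch. II §10, Lemma (2.10.A)–Thm (2.10.B)] -/
theorem exists_mvPolynomial_eval_ne_zero_iff_isUnit (c : ι → Matrix n n K) :
    ∃ p : MvPolynomial ι K, p ≠ 0 ∧ ∀ t : ι → K, (MvPolynomial.eval t p ≠ 0 ↔
      IsUnit ((2 : K) • (∑ i, t i • c i) - 1) ∧ IsUnit ((2 : K) • (∑ i, t i • c i) + 1)) := by
  obtain ⟨p, hp, he⟩ := exists_mvPolynomial_eval_eq_det c
  refine ⟨p, hp, fun t => ?_⟩
  rw [he, mul_ne_zero_iff, Matrix.isUnit_iff_isUnit_det, Matrix.isUnit_iff_isUnit_det, isUnit_iff_ne_zero,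
    isUnit_iff_ne_zero]

end MatrixFamilyField

/-! ### §2 Families of endomorphisms of a finite free module -/

section EndFamily

variable {K : Type*} [CommRing K] {ι : Type*} [Fintype ι] {V : Type*} [AddCommGroup V] [Module K V]

/-- In a basis `b`, the matrix of `2 Σ tᵢ cᵢ − 1` is `2 Σ tᵢ [cᵢ]_b − 1`. [folklore] -/
private theorem toMatrix_two_smul_sum_smul_sub_one {m : Type*} [Fintype m] [DecidableEq m] (b : Module.Basis m K V)
    (c : ι → Module.End K V) (t : ι → K) :
    LinearMap.toMatrix b b ((2 : K) • (∑ i, t i • c i) - 1) =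
      (2 : K) • (∑ i, t i • LinearMap.toMatrix b b (c i)) - 1 := by
  simp only [map_sub, map_smul, map_sum, LinearMap.toMatrix_one]

/-- In a basis `b`, the matrix of `2 Σ tᵢ cᵢ + 1` is `2 Σ tᵢ [cᵢ]_b + 1`. [folklore] -/
private theorem toMatrix_two_smul_sum_smul_add_one {m : Type*} [Fintype m] [DecidableEq m] (b : Module.Basis m K V)
    (c : ι → Module.End K V) (t : ι → K) :
    LinearMap.toMatrix b b ((2 : K) • (∑ i, t i • c i) + 1) =
      (2 : K) • (∑ i, t i • LinearMap.toMatrix b b (c i)) + 1 := by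
  simp only [map_add, map_smul, map_sum, LinearMap.toMatrix_one]

/-- `det(2 Σ tᵢ cᵢ − 1) · det(2 Σ tᵢ cᵢ + 1)` (determinants of endomorphisms) equals the same expression for the
matrices in any basis. [folklore] -/
private theorem linearMapDet_two_smul_sum_smul_eq {m : Type*} [Fintype m] [DecidableEq m] (b : Module.Basis m K V)
    (c : ι → Module.End K V) (t : ι → K) :
    LinearMap.det ((2 : K) • (∑ i, t i • c i) - 1) * LinearMap.det ((2 : K) • (∑ i, t i • c i) + 1) =
      ((2 : K) • (∑ i, t i • LinearMap.toMatrix b b (c i)) - 1).det *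
        ((2 : K) • (∑ i, t i • LinearMap.toMatrix b b (c i)) + 1).det := by
  rw [← LinearMap.det_toMatrix b, ← LinearMap.det_toMatrix b, toMatrix_two_smul_sum_smul_sub_one,
    toMatrix_two_smul_sum_smul_add_one]

variable [Module.Free K V] [Module.Finite K V]

/-- **Endomorphism form**: for a family `c : ι → End_K(V)` of endomorphisms of a finite free module over a
non-trivial commutative ring there is a non-zero `p ∈ K[X_i : i ∈ ι]` with
`p(t) = det(2 Σ tᵢ cᵢ − 1) · det(2 Σ tᵢ cᵢ + 1)` (`LinearMap.det`) for all `t : ι → K`.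
[cite: Weyl1939, Ch. II §10 with Lemma (1.1.A)] -/
theorem exists_mvPolynomial_eval_eq_linearMapDet [Nontrivial K] (c : ι → Module.End K V) :
    ∃ p : MvPolynomial ι K, p ≠ 0 ∧ ∀ t : ι → K, MvPolynomial.eval t p =
      LinearMap.det ((2 : K) • (∑ i, t i • c i) - 1) * LinearMap.det ((2 : K) • (∑ i, t i • c i) + 1) := by
  classical
  obtain ⟨p, hp, he⟩ :=
    exists_mvPolynomial_eval_eq_det fun i => LinearMap.toMatrix (Module.Free.chooseBasis K V)
      (Module.Free.chooseBasis K V) (c i)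
  exact ⟨p, hp, fun t => by rw [he, linearMapDet_two_smul_sum_smul_eq (Module.Free.chooseBasis K V)]⟩

end EndFamily

section EndFamilyField

variable {K : Type*} [Field K] {ι : Type*} [Fintype ι] {V : Type*} [AddCommGroup V] [Module K V]
  [Module.Finite K V]

/-- **Endomorphism form over a field**: a non-zero `p ∈ K[X_i]` with
`p(t) ≠ 0 ↔ IsUnit (2 Σ tᵢ cᵢ − 1) ∧ IsUnit (2 Σ tᵢ cᵢ + 1)` — exactly the hypotheses of the Cayley–Siegel
decomposition `Literature.LinearAlgebra.Semilinear.exists_cayley_siegel_decomposition` /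
`isUnit_and_isUnit_iff_det_ne_zero`. [cite: Weyl1939, Ch. II §10, Lemma (2.10.A)–Thm (2.10.B)] -/
theorem exists_mvPolynomial_eval_ne_zero_iff_isUnit_end (c : ι → Module.End K V) :
    ∃ p : MvPolynomial ι K, p ≠ 0 ∧ ∀ t : ι → K, (MvPolynomial.eval t p ≠ 0 ↔
      IsUnit ((2 : K) • (∑ i, t i • c i) - 1) ∧ IsUnit ((2 : K) • (∑ i, t i • c i) + 1)) := by
  obtain ⟨p, hp, he⟩ := exists_mvPolynomial_eval_eq_linearMapDet c
  refine ⟨p, hp, fun t => ?_⟩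
  rw [he, mul_ne_zero_iff, LinearMap.isUnit_iff_isUnit_det, LinearMap.isUnit_iff_isUnit_det, isUnit_iff_ne_zero,
    isUnit_iff_ne_zero]

end EndFamilyField

/-! ### §3 Scalar tower: `E`-linear families with coordinates in a subfield `F` -/

section Tower

variable {F E V : Type*} [Field F] [CommRing E] [Algebra F E] [AddCommGroup V] [Module E V] [Module F V]
  [IsScalarTower F E V] {ι : Type*} [Fintype ι]

/-- Invertibility of an `E`-linear endomorphism does not see the scalars: it is invertible iff the underlying
`F`-linear map is (both mean bijective). [folklore] -/
private theorem isUnit_iff_isUnit_restrictScalars (f : Module.End E V) :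
    IsUnit f ↔ IsUnit (f.restrictScalars F : Module.End F V) := by
  rw [Module.End.isUnit_iff, Module.End.isUnit_iff]
  rfl

/-- Restricting scalars in `2 Σ tᵢ cᵢ − 1` (`tᵢ ∈ F`, `cᵢ ∈ End_E V`). [folklore] -/
private theorem restrictScalars_two_smul_sum_smul_sub_one (c : ι → Module.End E V) (t : ι → F) :
    ((2 : E) • (∑ i, t i • c i) - 1 : Module.End E V).restrictScalars F =
      (2 : F) • (∑ i, t i • (c i).restrictScalars F) - 1 := by
  ext v
  simp [two_smul]

/-- Restricting scalars in `2 Σ tᵢ cᵢ + 1` (`tᵢ ∈ F`, `cᵢ ∈ End_E V`). [folklore] -/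
private theorem restrictScalars_two_smul_sum_smul_add_one (c : ι → Module.End E V) (t : ι → F) :
    ((2 : E) • (∑ i, t i • c i) + 1 : Module.End E V).restrictScalars F =
      (2 : F) • (∑ i, t i • (c i).restrictScalars F) + 1 := by
  ext v
  simp [two_smul]

variable [Module.Finite F V]

/-- **Scalar-tower form**: `E` an `F`-algebra (`F` a field), `V` an `E`-module, finite over `F`,
`c : ι → End_E(V)`.  There is a non-zero `p ∈ F[X_i : i ∈ ι]` (coefficients in the SMALL field: it is
`det_F(2 Σ tᵢ cᵢ − 1) · det_F(2 Σ tᵢ cᵢ + 1)` for the underlying `F`-linear maps) such that for `t : ι → F`,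
`p(t) ≠ 0 ↔ 2 Σ tᵢ cᵢ − 1` and `2 Σ tᵢ cᵢ + 1` are invertible as `E`-linear maps.  (Use: hermitian /
skew-hermitian operators form an `F`-subspace, not an `E`-subspace, of `End_E(V)` — Weyl's unitary case over
`(k, √−1)` with coordinates in `k`.) [cite: Weyl1939, Ch. VI §2 with Ch. II §10] -/
theorem exists_mvPolynomial_eval_ne_zero_iff_isUnit_tower (c : ι → Module.End E V) :
    ∃ p : MvPolynomial ι F, p ≠ 0 ∧ ∀ t : ι → F, (MvPolynomial.eval t p ≠ 0 ↔
      IsUnit ((2 : E) • (∑ i, t i • c i) - 1) ∧ IsUnit ((2 : E) • (∑ i, t i • c i) + 1)) := by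
  obtain ⟨p, hp, he⟩ := exists_mvPolynomial_eval_ne_zero_iff_isUnit_end (K := F) fun i => (c i).restrictScalars F
  refine ⟨p, hp, fun t => ?_⟩
  rw [he, isUnit_iff_isUnit_restrictScalars (F := F) ((2 : E) • (∑ i, t i • c i) - 1),
    isUnit_iff_isUnit_restrictScalars (F := F) ((2 : E) • (∑ i, t i • c i) + 1),
    restrictScalars_two_smul_sum_smul_sub_one, restrictScalars_two_smul_sum_smul_add_one]

end Tower

end Literature.LinearAlgebra.Matrix
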